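import Literature.RepresentationTheory.FiniteGroups.AldousOrder
import HarnessLib
import Literature.RepresentationTheory.FiniteGroups.InterchangeSpectralGap
import Literature.RepresentationTheory.FiniteGroups.SymmetricGroupIsotypic

/-!
# `λ₁` of the complete graph: the Diaconis–Shahshahani formula (discharge)

Topic `Literature/RepresentationTheory/FiniteGroups`; proofs companion of `AldousOrder.lean`. It
DISCHARGES the named fact `DiaconisShahshahani_lambdaOne_complete` stated there:

  `λ₁(K_n; μ) = aldousLambdaOneFin n 1 μ = binom(n,2) - contentSum μ` for every `μ ⊢ n`,

i.e. the interchange Laplacian `L_{K_n} = ∑_{x<y} (1 - (x y))` of the complete graph acts on the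
`μ`-isotypic component of `ℂ[𝔖ₙ]` as the scalar `binom(n,2) - ∑_{(i,j) ∈ μ} (j - i)`
(Alon–Kozma, *Ordering the representations of `S_n` using the interchange process*, §3,
proof of Lemma 3 (2): "`Δ_{K_n}` acts on `[α]` via the scalar
`binom(n,2) - ∑_j (binom(l_j-j+1,2) - binom(j,2))`", `l_j` the rows of `α`, which they take from
the trace of a transposition on `[α]` in Diaconis–Shahshahani [DS81]).

## The proof

Write `T = ∑_{x<y} (x y) ∈ ℂ[𝔖ₙ]` (the sum of all transpositions) and
`κ = contentSum μ`.

1. `T` is central (`of_mul_sum_swap_comm`, `mul_sum_swap_comm`): conjugation permutes the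
   transpositions (we symmetrise to ordered pairs and reindex).
2. With `a = a_μ`, `b = b_μ`, `c = c_μ = ab` the Young symmetrizer of the canonical tableau
   (`SymmetricGroupReps.lean`): for a transposition `(x y)`, `a (x y) b = c` if `x, y` share a
   row, `-c` if they share a column, and `0` otherwise
   (`rowSymmetrizer_mul_swap_mul_colAntisymmetrizer`; Fulton–Harris Lemma 4.21: in the last case,
   with `y'` in the row of `x` and the column of `y`,
   `a (x y) b = a (x y')(x y) b = a (x y)(y y') b = -a (x y) b`). Hence
   `T c = a T b = (#{row pairs} - #{column pairs}) c = κ c` (`sum_swap_mul_youngSymmetrizer`),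
   the count being `∑_y colOf y - ∑_y rowOf y = ∑_{(i,j) ∈ μ} (j - i)` in the row-reading
   tableau (`sum_sum_rowInd_sub_colInd`).
3. So `T` is the scalar `κ` on `S^μ = ℂ[𝔖ₙ] c` (`sum_spechtRep_swap`), whence the character
   identity `∑_{x<y} χ^μ(s (x y)) = κ χ^μ(s)` (`sum_spechtCharacter_mul_swap`; at `s = 1` this is
   the trace of a transposition on `[μ]`), whence `(∑_{x<y} ρ((x y))) P_μ = κ P_μ` for the
   isotypic projector `P_μ = (f^μ/n!) ∑_t χ^μ(t) ρ(t⁻¹)` of ANY representation `ρ`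
   (`sum_rep_swap_isotypicProj`).
4. In the left regular representation: `L_{K_n} P_μ f = (binom(n,2) - κ) P_μ f`
   (`interchangeLaplacian_one_isotypicProj`), every Rayleigh quotient on the `μ`-isotypic
   component is `binom(n,2) - κ` (`rayleighQuotient_one_of_mem`), the component is non-zero
   (`P_μ δ₁ (1) = (f^μ)²/n! ≠ 0`, `isotypicProj_permLeftRegular_single_ne_zero`), and the infimum
   of a singleton is its element (`DiaconisShahshahani_lambdaOne_complete_holds`).

Alon–Kozma (and Diaconis–Shahshahani, through Frobenius's formula) obtain the scalar from the
character table; the Young-symmetrizer computation of step 2 is the standard elementary route to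
the same central character and needs only Fulton–Harris Lemma 4.21, already in the tree.

## References

* G. Alon, G. Kozma, *Ordering the representations of `S_n` using the interchange process*,
  Canad. Math. Bull. 56 (2013) 13–30, arXiv:1003.1710, §3 proof of Lemma 3 (2). [AlonKozma2013]
* P. Diaconis, M. Shahshahani, *Generating a random permutation with random transpositions*,
  Z. Wahrsch. Verw. Gebiete 57 (1981) 159–179 (the trace of a transposition on `[μ]`, cited by
  Alon–Kozma as [DS81]). [DiaconisShahshahani1981]
* W. Fulton, J. Harris, *Representation Theory. A First Course*, GTM 129 (1991), Lemma 4.21.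
  [FultonHarrisGTM129]

## Mathlib and tree

Mathlib: `MonoidAlgebra.of`, `MonoidAlgebra.induction_on`, `Equiv.mul_swap_eq_swap_mul`,
`Equiv.swap_mul_eq_mul_swap`, `Equiv.Perm.sign_swap`, `Ideal.mem_span_singleton'`,
`Finset.sum_comm'`, `Finset.sum_boole`, `Finset.card_nbij`, `Finset.sum_nbij`, `Fin.card_Ioi`,
`Finset.sum_range_reflect`, `Nat.choose_two_right`, `YoungDiagram.up_left_mem`, `LinearMap.trace`,
`Complex.conj_mul'`, `csInf_singleton`. Tree: `permLeftRegular`, `interchangeLaplacian`,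
`rayleighQuotient`, `isotypicComponent`, `aldousLambdaOneFin` (`AldousLambdaOne.lean`);
`contentSum`, `DiaconisShahshahani_lambdaOne_complete` (`AldousOrder.lean`); `isotypicProj_apply`
(`IsotypicProjector.lean`); `rowSymmetrizer`, `colAntisymmetrizer`, `youngSymmetrizer`,
`spechtIdeal`, `spechtRep_apply`, `spechtCharacter_apply` (`SymmetricGroupReps.lean`);
`rowSymmetrizer_mul_of`, `of_mul_colAntisymmetrizer`, `swap_mem_rowStabilizer`
(`SymmetricGroupRepsIrreducibleProofs.lean`); `swap_mem_colStabilizer`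
(`SchurWeylPlethysmProofs.lean`); `rowOf_colOf_injective`, `eq_of_rowOf_eq_of_colOf_eq`,
`exists_rowOf_eq_and_colOf_eq`, `exists_rowOf_eq_of_le`, `rowOf_lt_colLen`,
`card_filter_colOf_eq_and_rowOf_lt` (`SchurWeylHighestWeightProofs.lean`); `rowOf_mono`
(`SymmetricGroupRepsFinrankSpechtProofs.lean`); `spechtCharacter_one_ne_zero'`
(`SymmetricGroupFrobeniusFormula.lean`); `Nat.Partition.val_eq_sum_take_rowOf_add_colOf`,
`rowOf_colOf_mem_youngDiagram` (`PartitionTableaux.lean`). All of these are already imported by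
`AldousOrder.lean`.

## Design

Theorems only (no new definitions, notations or facts): `T` is written out as
`∑ x, ∑ y with x < y, MonoidAlgebra.of ℂ _ (Equiv.swap x y)`, matching the shape of
`interchangeLaplacian`. The scalar statements of step 3 hold for every complex representation of
`Equiv.Perm (Fin n)` and are stated in that generality (they also compute `lambdaOneRep` of
`AldousOrder.lean` on irreducibles, not done here).
-/

noncomputable section

open scoped BigOperators ComplexConjugate
open Module

namespace Literature.RepresentationTheory.FiniteGroups

open _root_.Literature.NumberTheory.DiophantineGeometry

section CompleteGraph

variable {n : ℕ}

/-! #### Sums over pairs `x < y` -/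

/-- For a symmetric function of two sites, twice the sum over the pairs `x < y` is the sum over
the ordered pairs `x ≠ y`. [folklore] -/
theorem sum_sum_lt_add_self {M : Type*} [AddCommMonoid M] (g : Fin n → Fin n → M)
    (hg : ∀ x y, g x y = g y x) :
    (∑ x : Fin n, ∑ y : Fin n with x < y, g x y) + (∑ x : Fin n, ∑ y : Fin n with x < y, g x y) =
      ∑ x : Fin n, ∑ y : Fin n, if x = y then 0 else g x y := by
  have h1 : (∑ x : Fin n, ∑ y : Fin n with x < y, g x y) =
      ∑ x : Fin n, ∑ y : Fin n, if x < y then g x y else 0 :=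
    Finset.sum_congr rfl fun x _ => Finset.sum_filter _ _
  have h2 : (∑ x : Fin n, ∑ y : Fin n with x < y, g x y) =
      ∑ x : Fin n, ∑ y : Fin n, if y < x then g x y else 0 := by
    rw [h1, Finset.sum_comm]
    refine Finset.sum_congr rfl fun x _ => Finset.sum_congr rfl fun y _ => ?_
    split_ifs
    · exact hg y x
    · rfl
  nth_rewrite 1 [h1]
  rw [h2, ← Finset.sum_add_distrib]
  refine Finset.sum_congr rfl fun x _ => ?_
  rw [← Finset.sum_add_distrib]
  refine Finset.sum_congr rfl fun y _ => ?_
  rcases lt_trichotomy x y with hlt | rfl | hgt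
  · rw [if_pos hlt, if_neg (not_lt.mpr hlt.le), if_neg hlt.ne, add_zero]
  · simp
  · rw [if_neg (not_lt.mpr hgt.le), if_pos hgt, if_neg hgt.ne', zero_add]

/-- Reindexing a double sum over the sites by a permutation. [folklore] -/
theorem sum_sum_perm_apply {M : Type*} [AddCommMonoid M] (σ : Equiv.Perm (Fin n))
    (G : Fin n → Fin n → M) :
    ∑ x : Fin n, ∑ y : Fin n, G (σ x) (σ y) = ∑ x : Fin n, ∑ y : Fin n, G x y :=
  calc ∑ x : Fin n, ∑ y : Fin n, G (σ x) (σ y) = ∑ x : Fin n, ∑ y : Fin n, G x (σ y) :=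
        Equiv.sum_comp σ (fun a => ∑ y, G a (σ y))
    _ = ∑ x : Fin n, ∑ y : Fin n, G x y :=
        Finset.sum_congr rfl fun a _ => Equiv.sum_comp σ (G a)

/-- The number of pairs `x < y` of sites is `n(n-1)/2`. [folklore] -/
theorem sum_card_filter_lt :
    ∑ x : Fin n, (Finset.univ.filter fun y : Fin n => x < y).card = n.choose 2 := by
  simp_rw [Finset.filter_lt_eq_Ioi, Fin.card_Ioi]
  rw [Fin.sum_univ_eq_sum_range (fun a => n - 1 - a) n, Finset.sum_range_reflect (fun a => a) n,
    Finset.sum_range_id, Nat.choose_two_right]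

/-! #### The sum of all transpositions is central -/

/-- **The sum of all transpositions `T = ∑_{x<y} (x y)` is central in `ℂ[𝔖ₙ]`**: it commutes
with every permutation (conjugation by `σ` permutes the transpositions; we pass to the sum over
ordered pairs `x ≠ y`, which is `2T`, and reindex by `σ`). [folklore] -/
theorem of_mul_sum_swap_comm (σ : Equiv.Perm (Fin n)) :
    MonoidAlgebra.of ℂ _ σ * (∑ x : Fin n, ∑ y : Fin n with x < y,
        MonoidAlgebra.of ℂ (Equiv.Perm (Fin n)) (Equiv.swap x y)) =
      (∑ x : Fin n, ∑ y : Fin n with x < y,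
        MonoidAlgebra.of ℂ (Equiv.Perm (Fin n)) (Equiv.swap x y)) * MonoidAlgebra.of ℂ _ σ := by
  set T := ∑ x : Fin n, ∑ y : Fin n with x < y,
    MonoidAlgebra.of ℂ (Equiv.Perm (Fin n)) (Equiv.swap x y) with hT
  set G : Fin n → Fin n → MonoidAlgebra ℂ (Equiv.Perm (Fin n)) :=
    fun x y => if x = y then 0 else MonoidAlgebra.of ℂ _ (Equiv.swap x y) with hG
  have h2 : T + T = ∑ x, ∑ y, G x y :=
    sum_sum_lt_add_self _ fun x y => by rw [Equiv.swap_comm]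
  have hS : MonoidAlgebra.of ℂ _ σ * (∑ x, ∑ y, G x y) =
      (∑ x, ∑ y, G x y) * MonoidAlgebra.of ℂ _ σ := by
    rw [Finset.mul_sum, Finset.sum_mul]
    calc ∑ x, MonoidAlgebra.of ℂ _ σ * ∑ y, G x y
        = ∑ x, ∑ y, G (σ x) (σ y) * MonoidAlgebra.of ℂ _ σ := by
          refine Finset.sum_congr rfl fun x _ => ?_
          rw [Finset.mul_sum]
          refine Finset.sum_congr rfl fun y _ => ?_
          simp only [hG]
          by_cases hxy : x = y
          · rw [if_pos hxy, if_pos (by rw [hxy]), mul_zero, zero_mul]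
          · rw [if_neg hxy, if_neg (σ.injective.ne hxy),
              ← (MonoidAlgebra.of ℂ (Equiv.Perm (Fin n))).map_mul, Equiv.mul_swap_eq_swap_mul,
              (MonoidAlgebra.of ℂ (Equiv.Perm (Fin n))).map_mul]
      _ = ∑ x, ∑ y, G x y * MonoidAlgebra.of ℂ _ σ :=
          sum_sum_perm_apply σ (fun x y => G x y * MonoidAlgebra.of ℂ _ σ)
      _ = ∑ x, (∑ y, G x y) * MonoidAlgebra.of ℂ _ σ :=
          Finset.sum_congr rfl fun x _ => (Finset.sum_mul _ _ _).symm
  have hT2 : T = (2⁻¹ : ℂ) • (∑ x, ∑ y, G x y) := by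
    rw [← h2, ← two_smul ℂ T, smul_smul, inv_mul_cancel₀ two_ne_zero, one_smul]
  rw [hT2, mul_smul_comm, smul_mul_assoc, hS]

/-- Hence `T` commutes with every element of the group algebra. [folklore] -/
theorem mul_sum_swap_comm (w : MonoidAlgebra ℂ (Equiv.Perm (Fin n))) :
    w * (∑ x : Fin n, ∑ y : Fin n with x < y,
        MonoidAlgebra.of ℂ (Equiv.Perm (Fin n)) (Equiv.swap x y)) =
      (∑ x : Fin n, ∑ y : Fin n with x < y,
        MonoidAlgebra.of ℂ (Equiv.Perm (Fin n)) (Equiv.swap x y)) * w := by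
  induction w using MonoidAlgebra.induction_on with
  | hM g => exact of_mul_sum_swap_comm g
  | hadd x y hx hy => rw [add_mul, mul_add, hx, hy]
  | hsmul r x hx => rw [smul_mul_assoc, mul_smul_comm, hx]

/-! #### `a_μ (x y) b_μ` for a transposition `(x y)` (Fulton–Harris, Lemma 4.21) -/

/-- If `x` lies in a strictly higher row than `y` and in a different column, then
`a_μ (x y) b_μ = 0`: with `y'` the entry in the row of `x` and the column of `y`,
`a (x y) b = a (x y') (x y) b = a (x y) (y y') b = -a (x y) b` (the argument of Fulton–Harris,
Lemma 4.21 (3)). [cite: FultonHarrisGTM129, Lemma 4.21 (3) (proof)] -/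
theorem rowSymmetrizer_mul_swap_mul_colAntisymmetrizer_eq_zero (μ : Nat.Partition n)
    {x y : Fin n} (hrow : μ.rowOf x < μ.rowOf y) (hcol : μ.colOf x ≠ μ.colOf y) :
    rowSymmetrizer ℂ μ * MonoidAlgebra.of ℂ _ (Equiv.swap x y) * colAntisymmetrizer ℂ μ = 0 := by
  obtain ⟨y', hy'r, hy'c⟩ := exists_rowOf_eq_of_le μ y hrow.le
  have hy'x : y' ≠ x := fun h => hcol (by rw [← h, hy'c])
  have hy'y : y' ≠ y := fun h => hrow.ne (by rw [← hy'r, h])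
  have hs : Equiv.swap x y' ∈ rowStabilizer μ := swap_mem_rowStabilizer μ hy'r.symm
  have ht' : Equiv.swap y y' ∈ colStabilizer μ := swap_mem_colStabilizer μ hy'c.symm
  set X := rowSymmetrizer ℂ μ * MonoidAlgebra.of ℂ _ (Equiv.swap x y) * colAntisymmetrizer ℂ μ
    with hX
  have hneg : X = -X := by
    calc X = rowSymmetrizer ℂ μ * MonoidAlgebra.of ℂ _ (Equiv.swap x y') *
          MonoidAlgebra.of ℂ _ (Equiv.swap x y) * colAntisymmetrizer ℂ μ := by
          rw [rowSymmetrizer_mul_of hs]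
      _ = rowSymmetrizer ℂ μ * MonoidAlgebra.of ℂ _ (Equiv.swap x y) *
          (MonoidAlgebra.of ℂ _ (Equiv.swap y y') * colAntisymmetrizer ℂ μ) := by
          rw [mul_assoc (rowSymmetrizer ℂ μ), ← (MonoidAlgebra.of ℂ (Equiv.Perm (Fin n))).map_mul,
            Equiv.swap_mul_eq_mul_swap, (MonoidAlgebra.of ℂ (Equiv.Perm (Fin n))).map_mul]
          simp only [Equiv.swap_inv, Equiv.swap_apply_left,
            Equiv.swap_apply_of_ne_of_ne hy'x hy'y, mul_assoc]
      _ = -X := by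
          rw [of_mul_colAntisymmetrizer ht', Equiv.Perm.sign_swap hy'y.symm, Units.val_neg,
            Units.val_one, Int.cast_neg, Int.cast_one, mul_smul_comm, neg_smul, one_smul]
  have h2 : (2 : ℂ) • X = 0 := by
    rw [two_smul]
    nth_rewrite 2 [hneg]
    exact add_neg_cancel X
  calc X = (2 : ℂ)⁻¹ • ((2 : ℂ) • X) := (inv_smul_smul₀ two_ne_zero X).symm
    _ = 0 := by rw [h2, smul_zero]

/-- **`a_μ (x y) b_μ` for a transposition** (`x ≠ y`): `c_μ` if `x, y` lie in one row of the
canonical tableau (`a (x y) = a`), `-c_μ` if they lie in one column (`(x y) b = -b`), and `0`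
otherwise (Fulton–Harris, Lemma 4.21). [cite: FultonHarrisGTM129, Lemma 4.21] -/
theorem rowSymmetrizer_mul_swap_mul_colAntisymmetrizer (μ : Nat.Partition n) {x y : Fin n}
    (hxy : x ≠ y) :
    rowSymmetrizer ℂ μ * MonoidAlgebra.of ℂ _ (Equiv.swap x y) * colAntisymmetrizer ℂ μ =
      ((if μ.rowOf x = μ.rowOf y then 1 else 0) - (if μ.colOf x = μ.colOf y then 1 else 0) : ℂ) •
        youngSymmetrizer ℂ μ := by
  by_cases hrow : μ.rowOf x = μ.rowOf y
  · have hcol : μ.colOf x ≠ μ.colOf y := fun h => hxy (eq_of_rowOf_eq_of_colOf_eq μ hrow h)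
    rw [if_pos hrow, if_neg hcol, sub_zero, one_smul,
      rowSymmetrizer_mul_of (swap_mem_rowStabilizer μ hrow), youngSymmetrizer]
  · by_cases hcol : μ.colOf x = μ.colOf y
    · rw [if_neg hrow, if_pos hcol, zero_sub, neg_smul, one_smul, mul_assoc,
        of_mul_colAntisymmetrizer (swap_mem_colStabilizer μ hcol), Equiv.Perm.sign_swap hxy,
        Units.val_neg, Units.val_one, Int.cast_neg, Int.cast_one, mul_smul_comm, neg_smul,
        one_smul, youngSymmetrizer]
    · rw [if_neg hrow, if_neg hcol, sub_zero, zero_smul]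
      rcases lt_or_gt_of_ne hrow with hlt | hgt
      · exact rowSymmetrizer_mul_swap_mul_colAntisymmetrizer_eq_zero μ hlt hcol
      · rw [Equiv.swap_comm]
        exact rowSymmetrizer_mul_swap_mul_colAntisymmetrizer_eq_zero μ hgt (Ne.symm hcol)

/-! #### Counting row pairs and column pairs: the content -/

/-- The entries numbered before `y` in the row of `y` are as many as the column index of `y`.
[folklore] -/
theorem card_filter_lt_and_rowOf_eq (μ : Nat.Partition n) (y : Fin n) :
    (Finset.univ.filter fun x : Fin n => x < y ∧ μ.rowOf x = μ.rowOf y).card = μ.colOf y := by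
  rw [← Finset.card_range (μ.colOf y)]
  refine Finset.card_nbij (fun x => μ.colOf x) ?_ ?_ ?_
  · intro x hx
    simp only [Finset.coe_filter, Finset.mem_univ, true_and, Set.mem_setOf_eq] at hx
    simp only [Finset.coe_range, Set.mem_Iio]
    have h1 := μ.val_eq_sum_take_rowOf_add_colOf x
    have h2 := μ.val_eq_sum_take_rowOf_add_colOf y
    have h3 := Fin.lt_def.mp hx.1
    rw [hx.2] at h1
    omega
  · intro x hx x' hx' h
    simp only [Finset.coe_filter, Finset.mem_univ, true_and, Set.mem_setOf_eq] at hx hx'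
    exact eq_of_rowOf_eq_of_colOf_eq μ (hx.2.trans hx'.2.symm) h
  · intro c hc
    simp only [Finset.coe_range, Set.mem_Iio] at hc
    obtain ⟨x, hxr, hxc⟩ := exists_rowOf_eq_and_colOf_eq μ
      (μ.youngDiagram.up_left_mem le_rfl hc.le (μ.rowOf_colOf_mem_youngDiagram y))
    refine ⟨x, ?_, hxc⟩
    simp only [Finset.coe_filter, Finset.mem_univ, true_and, Set.mem_setOf_eq]
    refine ⟨?_, hxr⟩
    have h1 := μ.val_eq_sum_take_rowOf_add_colOf x
    have h2 := μ.val_eq_sum_take_rowOf_add_colOf y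
    rw [hxr] at h1
    rw [Fin.lt_def]
    omega

/-- The entries numbered before `y` in the column of `y` are as many as the row index of `y`.
[folklore] -/
theorem card_filter_lt_and_colOf_eq (μ : Nat.Partition n) (y : Fin n) :
    (Finset.univ.filter fun x : Fin n => x < y ∧ μ.colOf x = μ.colOf y).card = μ.rowOf y := by
  have hset : (Finset.univ.filter fun x : Fin n => x < y ∧ μ.colOf x = μ.colOf y) =
      Finset.univ.filter fun x : Fin n => μ.colOf x = μ.colOf y ∧ μ.rowOf x < μ.rowOf y := by
    refine Finset.filter_congr fun x _ => ?_
    constructor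
    · rintro ⟨hlt, hc⟩
      refine ⟨hc, lt_of_le_of_ne (rowOf_mono μ hlt.le) fun h => ?_⟩
      exact hlt.ne (eq_of_rowOf_eq_of_colOf_eq μ h hc)
    · rintro ⟨hc, hr⟩
      refine ⟨?_, hc⟩
      by_contra hle
      exact (not_le.mpr hr) (rowOf_mono μ (not_lt.mp hle))
  rw [hset, card_filter_colOf_eq_and_rowOf_lt, min_eq_left (rowOf_lt_colLen μ y).le]

/-- **The content as row pairs minus column pairs**: over the pairs `x < y` of entries of the
canonical tableau, `#{same row} - #{same column} = contentSum μ = ∑_{(i,j) ∈ μ} (j - i)`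
(`= ∑_y colOf y - ∑_y rowOf y` in the row-reading tableau). [folklore] -/
theorem sum_sum_rowInd_sub_colInd (μ : Nat.Partition n) :
    ∑ x : Fin n, ∑ y : Fin n with x < y,
        ((if μ.rowOf x = μ.rowOf y then (1 : ℤ) else 0) -
          (if μ.colOf x = μ.colOf y then 1 else 0)) = contentSum μ := by
  -- exchange the order of summation
  have hswap : ∀ f : Fin n → Fin n → ℤ,
      ∑ x : Fin n, ∑ y : Fin n with x < y, f x y = ∑ y : Fin n, ∑ x : Fin n with x < y, f x y :=
    fun f => Finset.sum_comm' fun x y => by simp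
  rw [hswap]
  simp only [Finset.sum_sub_distrib, Finset.sum_boole, Finset.filter_filter,
    card_filter_lt_and_rowOf_eq, card_filter_lt_and_colOf_eq]
  rw [← Finset.sum_sub_distrib, contentSum]
  refine Finset.sum_nbij (fun y => (μ.rowOf y, μ.colOf y)) ?_ ?_ ?_ ?_
  · exact fun y _ => (YoungDiagram.mem_cells _).mpr (μ.rowOf_colOf_mem_youngDiagram y)
  · exact fun a _ b _ h => rowOf_colOf_injective μ h
  · rintro ⟨i, j⟩ hc
    rw [Finset.mem_coe, YoungDiagram.mem_cells] at hc
    obtain ⟨y, h1, h2⟩ := exists_rowOf_eq_and_colOf_eq μ hc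
    exact ⟨y, by simp, Prod.ext h1 h2⟩
  · intro y _
    rfl

/-! #### `T c_μ = κ_μ c_μ`: the sum of all transpositions on the Specht module -/

/-- **`T c_μ = (contentSum μ) c_μ`**: `T c = T a b = a T b = ∑_{x<y} a (x y) b =
(#{row pairs} - #{column pairs}) c` (the scalar by which the central element `T` acts on `[μ]`,
i.e. Diaconis–Shahshahani's trace of a transposition, here through Young symmetrizers).
[cite: AlonKozma2013, §3 proof of Lemma 3 (2)] -/
theorem sum_swap_mul_youngSymmetrizer (μ : Nat.Partition n) :
    (∑ x : Fin n, ∑ y : Fin n with x < y,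
        MonoidAlgebra.of ℂ (Equiv.Perm (Fin n)) (Equiv.swap x y)) * youngSymmetrizer ℂ μ =
      (contentSum μ : ℂ) • youngSymmetrizer ℂ μ := by
  rw [youngSymmetrizer, ← mul_assoc, ← mul_sum_swap_comm (rowSymmetrizer ℂ μ)]
  simp only [Finset.mul_sum, Finset.sum_mul]
  calc ∑ x : Fin n, ∑ y : Fin n with x < y,
        rowSymmetrizer ℂ μ * MonoidAlgebra.of ℂ _ (Equiv.swap x y) * colAntisymmetrizer ℂ μ
      = ∑ x : Fin n, ∑ y : Fin n with x < y,
          ((if μ.rowOf x = μ.rowOf y then 1 else 0) -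
              (if μ.colOf x = μ.colOf y then 1 else 0) : ℂ) •
            (rowSymmetrizer ℂ μ * colAntisymmetrizer ℂ μ) := by
        refine Finset.sum_congr rfl fun x _ => Finset.sum_congr rfl fun y hy => ?_
        have hxy : x ≠ y := ((Finset.mem_filter.mp hy).2).ne
        rw [rowSymmetrizer_mul_swap_mul_colAntisymmetrizer μ hxy, youngSymmetrizer]
    _ = (∑ x : Fin n, ∑ y : Fin n with x < y,
          ((if μ.rowOf x = μ.rowOf y then 1 else 0) -
              (if μ.colOf x = μ.colOf y then 1 else 0) : ℂ)) •
            (rowSymmetrizer ℂ μ * colAntisymmetrizer ℂ μ) := by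
        rw [Finset.sum_smul]
        refine Finset.sum_congr rfl fun x _ => ?_
        rw [Finset.sum_smul]
    _ = (contentSum μ : ℂ) • (rowSymmetrizer ℂ μ * colAntisymmetrizer ℂ μ) := by
        congr 1
        exact_mod_cast sum_sum_rowInd_sub_colInd μ

/-- Hence `T z = (contentSum μ) z` on the whole Specht module `S^μ = ℂ[𝔖ₙ] c_μ` (`T` is
central). [cite: AlonKozma2013, §3 proof of Lemma 3 (2)] -/
theorem sum_swap_mul_of_mem_spechtIdeal (μ : Nat.Partition n)
    {z : MonoidAlgebra ℂ (Equiv.Perm (Fin n))} (hz : z ∈ spechtIdeal ℂ μ) :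
    (∑ x : Fin n, ∑ y : Fin n with x < y,
        MonoidAlgebra.of ℂ (Equiv.Perm (Fin n)) (Equiv.swap x y)) * z = (contentSum μ : ℂ) • z := by
  have hz' : z ∈ Ideal.span {youngSymmetrizer ℂ μ} := hz
  obtain ⟨w, rfl⟩ := Ideal.mem_span_singleton'.mp hz'
  rw [← mul_assoc, ← mul_sum_swap_comm w, mul_assoc, sum_swap_mul_youngSymmetrizer, mul_smul_comm]

/-- In the Specht representation, `∑_{x<y} ρ_μ((x y)) = (contentSum μ) · 1`.
[cite: AlonKozma2013, §3 proof of Lemma 3 (2)] -/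
theorem sum_spechtRep_swap (μ : Nat.Partition n) :
    ∑ x : Fin n, ∑ y : Fin n with x < y, spechtRep ℂ μ (Equiv.swap x y) =
      (contentSum μ : ℂ) • (1 : Module.End ℂ (spechtIdeal ℂ μ)) := by
  refine LinearMap.ext fun z => Subtype.ext ?_
  simp only [LinearMap.sum_apply, LinearMap.smul_apply, Module.End.one_apply, Submodule.coe_sum,
    Submodule.coe_smul_of_tower, spechtRep_apply]
  rw [← sum_swap_mul_of_mem_spechtIdeal μ z.2]
  simp only [Finset.sum_mul]

/-- **The central character at the transpositions**: for every `s ∈ 𝔖ₙ`,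
`∑_{x<y} χ^μ(s (x y)) = (contentSum μ) χ^μ(s)`; at `s = 1` this is the trace of a transposition on
`[μ]` which Alon–Kozma take from Diaconis–Shahshahani [DS81]:
`binom(n,2) χ^μ((1 2)) = f^μ ∑_j (binom(l_j-j+1,2) - binom(j,2))`.
[cite: AlonKozma2013, §3 proof of Lemma 3 (2)] -/
theorem sum_spechtCharacter_mul_swap (μ : Nat.Partition n) (s : Equiv.Perm (Fin n)) :
    ∑ x : Fin n, ∑ y : Fin n with x < y, spechtCharacter ℂ μ (s * Equiv.swap x y) =
      (contentSum μ : ℂ) * spechtCharacter ℂ μ s := by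
  simp only [spechtCharacter_apply, map_mul]
  calc ∑ x : Fin n, ∑ y : Fin n with x < y,
        LinearMap.trace ℂ _ (spechtRep ℂ μ s * spechtRep ℂ μ (Equiv.swap x y))
      = LinearMap.trace ℂ _ (spechtRep ℂ μ s *
          ∑ x : Fin n, ∑ y : Fin n with x < y, spechtRep ℂ μ (Equiv.swap x y)) := by
        simp only [Finset.mul_sum, map_sum]
    _ = (contentSum μ : ℂ) * LinearMap.trace ℂ _ (spechtRep ℂ μ s) := by
        rw [sum_spechtRep_swap, mul_smul_comm, mul_one, map_smul, smul_eq_mul]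

/-! #### The sum of all transpositions on the `μ`-isotypic component of any representation -/

/-- `ρ(g) P_χ v = ∑_u (χ(1)/|G|) χ(u g) ρ(u⁻¹) v` (reindex `t = u g` in
`P_χ v = ∑_t (χ(1)/|G|) χ(t) ρ(t⁻¹) v`). [folklore] -/
theorem rep_apply_isotypicProj_apply {G : Type} [Group G] [Fintype G] {W : Type*}
    [AddCommGroup W] [Module ℂ W] (ρ : Representation ℂ G W) (χ : G → ℂ) (g : G) (v : W) :
    ρ g (isotypicProj ρ χ v) = ∑ u : G, (χ 1 / Fintype.card G * χ (u * g)) • ρ u⁻¹ v := by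
  rw [isotypicProj_apply, map_sum]
  refine Fintype.sum_equiv (Equiv.mulRight g⁻¹) _ _ fun t => ?_
  simp only [Equiv.coe_mulRight, map_smul, inv_mul_cancel_right, mul_inv_rev, inv_inv]
  rw [← Module.End.mul_apply, ← map_mul]

/-- **On the `μ`-isotypic component of ANY representation `ρ` of `𝔖ₙ`, the sum of all
transpositions acts as the scalar `contentSum μ`**: `(∑_{x<y} ρ((x y))) P_μ = (contentSum μ) P_μ`
for the isotypic projector `P_μ = (f^μ/n!) ∑_t χ^μ(t) ρ(t⁻¹)`.
[cite: AlonKozma2013, §3 proof of Lemma 3 (2)] -/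
theorem sum_rep_swap_isotypicProj {W : Type*} [AddCommGroup W] [Module ℂ W]
    (ρ : Representation ℂ (Equiv.Perm (Fin n)) W) (μ : Nat.Partition n) (v : W) :
    (∑ x : Fin n, ∑ y : Fin n with x < y, ρ (Equiv.swap x y))
        (isotypicProj ρ (spechtCharacter ℂ μ) v) =
      (contentSum μ : ℂ) • isotypicProj ρ (spechtCharacter ℂ μ) v := by
  have hsum : ∀ u : Equiv.Perm (Fin n),
      ∑ x : Fin n, ∑ y : Fin n with x < y,
        (spechtCharacter ℂ μ 1 / Fintype.card (Equiv.Perm (Fin n)) *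
            spechtCharacter ℂ μ (u * Equiv.swap x y)) • ρ u⁻¹ v =
        (spechtCharacter ℂ μ 1 / Fintype.card (Equiv.Perm (Fin n)) *
          ((contentSum μ : ℂ) * spechtCharacter ℂ μ u)) • ρ u⁻¹ v := by
    intro u
    rw [← sum_spechtCharacter_mul_swap μ u, Finset.mul_sum, Finset.sum_smul]
    refine Finset.sum_congr rfl fun x _ => ?_
    rw [Finset.mul_sum, Finset.sum_smul]
  calc (∑ x : Fin n, ∑ y : Fin n with x < y, ρ (Equiv.swap x y))
        (isotypicProj ρ (spechtCharacter ℂ μ) v)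
      = ∑ x : Fin n, ∑ y : Fin n with x < y, ∑ u : Equiv.Perm (Fin n),
          (spechtCharacter ℂ μ 1 / Fintype.card (Equiv.Perm (Fin n)) *
            spechtCharacter ℂ μ (u * Equiv.swap x y)) • ρ u⁻¹ v := by
        simp only [LinearMap.sum_apply, rep_apply_isotypicProj_apply]
    _ = ∑ x : Fin n, ∑ u : Equiv.Perm (Fin n), ∑ y : Fin n with x < y,
          (spechtCharacter ℂ μ 1 / Fintype.card (Equiv.Perm (Fin n)) *
            spechtCharacter ℂ μ (u * Equiv.swap x y)) • ρ u⁻¹ v :=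
        Finset.sum_congr rfl fun x _ => Finset.sum_comm
    _ = ∑ u : Equiv.Perm (Fin n), ∑ x : Fin n, ∑ y : Fin n with x < y,
          (spechtCharacter ℂ μ 1 / Fintype.card (Equiv.Perm (Fin n)) *
            spechtCharacter ℂ μ (u * Equiv.swap x y)) • ρ u⁻¹ v := Finset.sum_comm
    _ = ∑ u : Equiv.Perm (Fin n), (spechtCharacter ℂ μ 1 / Fintype.card (Equiv.Perm (Fin n)) *
          ((contentSum μ : ℂ) * spechtCharacter ℂ μ u)) • ρ u⁻¹ v :=
        Finset.sum_congr rfl fun u _ => hsum u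
    _ = (contentSum μ : ℂ) • isotypicProj ρ (spechtCharacter ℂ μ) v := by
        rw [isotypicProj_apply, Finset.smul_sum]
        refine Finset.sum_congr rfl fun u _ => ?_
        rw [smul_smul]
        congr 1
        ring

/-! #### The complete graph in the regular representation -/

/-- **`L_{K_n} = binom(n,2) - contentSum μ` on the `μ`-isotypic component of `ℂ[𝔖ₙ]`**
(`L_{K_n} = ∑_{x<y} (1 - λ((x y))) = binom(n,2) - λ(T)` in the left regular representation `λ`).
[cite: AlonKozma2013, §3 proof of Lemma 3 (2)] -/
theorem interchangeLaplacian_one_isotypicProj (μ : Nat.Partition n)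
    (f₀ : Equiv.Perm (Fin n) → ℂ) :
    interchangeLaplacian n (fun _ _ => (1 : ℝ))
        (isotypicProj (permLeftRegular n) (spechtCharacter ℂ μ) f₀) =
      (((n.choose 2 : ℕ) : ℂ) - (contentSum μ : ℂ)) •
        isotypicProj (permLeftRegular n) (spechtCharacter ℂ μ) f₀ := by
  have hT : ∑ x : Fin n, ∑ y : Fin n with x < y, permLeftRegular n (Equiv.swap x y)
      (isotypicProj (permLeftRegular n) (spechtCharacter ℂ μ) f₀) =
      (contentSum μ : ℂ) • isotypicProj (permLeftRegular n) (spechtCharacter ℂ μ) f₀ := by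
    simpa only [LinearMap.sum_apply] using sum_rep_swap_isotypicProj (permLeftRegular n) μ f₀
  generalize isotypicProj (permLeftRegular n) (spechtCharacter ℂ μ) f₀ = v at hT ⊢
  have hL : interchangeLaplacian n (fun _ _ => (1 : ℝ)) =
      ∑ x : Fin n, ∑ y : Fin n with x < y, (1 - permLeftRegular n (Equiv.swap x y)) := by
    unfold interchangeLaplacian
    simp only [Complex.ofReal_one, one_smul]
  have hconst : ∑ x : Fin n, ∑ y : Fin n with x < y, v = ((n.choose 2 : ℕ) : ℂ) • v := by
    simp only [Finset.sum_const, ← Finset.sum_smul]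
    rw [sum_card_filter_lt, Nat.cast_smul_eq_nsmul]
  rw [hL, sub_smul, ← hT, ← hconst]
  simp only [LinearMap.sum_apply, LinearMap.sub_apply, Module.End.one_apply,
    Finset.sum_sub_distrib]

/-- The Rayleigh quotient of `L_{K_n}` at a non-zero vector of the `μ`-isotypic component is
`binom(n,2) - contentSum μ`. [cite: AlonKozma2013, §3 proof of Lemma 3 (2)] -/
theorem rayleighQuotient_one_of_mem (μ : Nat.Partition n) {f : Equiv.Perm (Fin n) → ℂ}
    (hf : f ∈ isotypicComponent n μ) (hf0 : f ≠ 0) :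
    rayleighQuotient n (fun _ _ => (1 : ℝ)) f = (n.choose 2 : ℝ) - (contentSum μ : ℝ) := by
  obtain ⟨f₀, rfl⟩ := LinearMap.mem_range.mp hf
  have hL := interchangeLaplacian_one_isotypicProj μ f₀
  generalize isotypicProj (permLeftRegular n) (spechtCharacter ℂ μ) f₀ = f at hL hf0 ⊢
  have hκC : (((n.choose 2 : ℕ) : ℂ) - (contentSum μ : ℂ)) =
      (((n.choose 2 : ℝ) - (contentSum μ : ℝ) : ℝ) : ℂ) := by
    push_cast
    rfl
  have hpos : 0 < ∑ h, ‖f h‖ ^ 2 := by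
    obtain ⟨h₀, hh₀⟩ : ∃ h, f h ≠ 0 := by
      by_contra hall
      push Not at hall
      exact hf0 (funext hall)
    exact Finset.sum_pos' (fun h _ => by positivity) ⟨h₀, Finset.mem_univ _, by positivity⟩
  have hsum : ∑ h, conj (f h) * ((((n.choose 2 : ℝ) - (contentSum μ : ℝ) : ℝ) : ℂ) • f) h =
      (((n.choose 2 : ℝ) - (contentSum μ : ℝ) : ℝ) : ℂ) * ((∑ h, ‖f h‖ ^ 2 : ℝ) : ℂ) := by
    rw [Complex.ofReal_sum, Finset.mul_sum]
    refine Finset.sum_congr rfl fun h _ => ?_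
    rw [Pi.smul_apply, smul_eq_mul, Complex.ofReal_pow, ← Complex.conj_mul']
    ring
  unfold rayleighQuotient
  rw [hL, hκC, hsum, Complex.re_ofReal_mul, Complex.ofReal_re, mul_div_assoc, div_self hpos.ne',
    mul_one]

/-- The `μ`-isotypic component of `ℂ[𝔖ₙ]` is non-zero: `P_μ δ₁ (1) = χ^μ(1)² / n! ≠ 0`.
[folklore] -/
theorem isotypicProj_permLeftRegular_single_ne_zero (μ : Nat.Partition n) :
    isotypicProj (permLeftRegular n) (spechtCharacter ℂ μ) (Pi.single 1 1) ≠ 0 := by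
  have hne : spechtCharacter ℂ μ 1 ≠ 0 := spechtCharacter_one_ne_zero' μ
  have hcard : (Fintype.card (Equiv.Perm (Fin n)) : ℂ) ≠ 0 :=
    Nat.cast_ne_zero.mpr Fintype.card_ne_zero
  intro h
  have h1 := congrFun h 1
  rw [isotypicProj_apply, Finset.sum_apply, Pi.zero_apply] at h1
  simp only [Pi.smul_apply, permLeftRegular_apply, inv_inv, mul_one, smul_eq_mul, Pi.single_apply,
    mul_ite, mul_one, mul_zero, Finset.sum_ite_eq', Finset.mem_univ, if_true] at h1
  exact mul_ne_zero (div_ne_zero hne hcard) hne h1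

/-- **Diaconis–Shahshahani's complete-graph formula, discharged**:
`λ₁(K_n; μ) = binom(n,2) - contentSum μ`, the interchange Laplacian of the complete graph being
this scalar on the (non-zero) `μ`-isotypic component of `ℂ[𝔖ₙ]`. Proof: the sum `T` of all
transpositions satisfies `T c_μ = a_μ T b_μ = (#{row pairs} - #{column pairs}) c_μ =
(contentSum μ) c_μ` (Young symmetrizers, Fulton–Harris Lemma 4.21), hence acts as `contentSum μ`
on `S^μ`, hence — through the character identity `∑_{x<y} χ^μ(s (x y)) = (contentSum μ) χ^μ(s)`
and the isotypic projector `P_μ = (f^μ/n!) ∑_t χ^μ(t) λ(t⁻¹)` — on the `μ`-isotypic component of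
every representation; Alon–Kozma read the same scalar off the trace of a transposition on `[μ]`
(Diaconis–Shahshahani [DS81]). [cite: AlonKozma2013, §3 proof of Lemma 3 (2)] -/
theorem DiaconisShahshahani_lambdaOne_complete_holds : DiaconisShahshahani_lambdaOne_complete := by
  intro n μ
  unfold aldousLambdaOneFin
  have hmem : isotypicProj (permLeftRegular n) (spechtCharacter ℂ μ) (Pi.single 1 1) ∈
      isotypicComponent n μ := LinearMap.mem_range_self _ _
  have hset : rayleighQuotient n (fun _ _ => (1 : ℝ)) ''
        {f | f ∈ isotypicComponent n μ ∧ f ≠ 0} =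
      {(n.choose 2 : ℝ) - (contentSum μ : ℝ)} := by
    refine Set.eq_singleton_iff_unique_mem.mpr ⟨?_, ?_⟩
    · exact ⟨_, ⟨hmem, isotypicProj_permLeftRegular_single_ne_zero μ⟩,
        rayleighQuotient_one_of_mem μ hmem (isotypicProj_permLeftRegular_single_ne_zero μ)⟩
    · rintro _ ⟨f, ⟨hf, hf0⟩, rfl⟩
      exact rayleighQuotient_one_of_mem μ hf hf0
  rw [hset, csInf_singleton]

end CompleteGraph

end Literature.RepresentationTheory.FiniteGroups

end

noncomputable section

/-!
# The Caputo–Liggett–Richthammer theorem `λ₁(A;[n−1,1]) ≤ λ₁(A;μ)` (discharge)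

This second part of the proofs companion DISCHARGES the named fact
`CaputoLiggettRichthammer_lambdaOne` of `AldousOrder.lean` (Aldous' spectral gap conjecture in the
representation-theoretic form of Alon–Kozma §1: `λ₁(A;[n−1,1]) ≤ λ₁(A;ρ)` for every irreducible
`ρ ≠ [n]` and all non-negative rates `A`), from the spectral-gap form of CLR's Theorem 1.1 proved in
`InterchangeSpectralGap.lean` (`gapRW_le_rayleighQuotient`: `λ₁^{RW}(A) ≤` every Rayleigh quotient of
`L_A` at a function orthogonal to the constants) through the dictionary of Alon–Kozma §1
("`λ₁(A;[n−1,1])` is the spectral gap of the random walk; the interchange process decomposes over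
the irreducible representations"):

* `sum_eq_zero_of_mem_isotypicComponent`: for `μ ≠ [n]` the `μ`-isotypic component of `ℂ[𝔖ₙ]` is
  orthogonal to the constants (`P_{[n]} P_μ = 0`, `P_{[n]}` = averaging), so
  `λ₁^{RW}(A) ≤ λ₁(A; μ)` (`gapRW_le_aldousLambdaOneFin`);
* the one-particle function `τ ↦ φ(τ q)`, `q` the last site, has Rayleigh quotient `𝓔^{RW}_A(φ)/‖φ‖²`
  (`rayleighQuotient_oneParticle`) and lies in the `[n−1,1]`-isotypic component when `∑ φ = 0`
  (`oneParticle_mem_isotypicComponent`): every isotypic projector acts on it by a scalar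
  (`isotypicProj_oneParticle`, a class-function computation), and the scalar of `[n−1,1]` is
  non-zero because `∑_{t(q)=q} χ^{[n−1,1]}(t) ≠ 0` (`sum_spechtCharacter_stabilizer_ne_zero`: the
  row stabilizer of the tableau of shape `[n−1,1]` is the stabilizer of `q`, and
  `∑_{t ∈ R} ρ(t)` is `|R|` times a non-zero idempotent on `S^{[n−1,1]}`, as it multiplies the Young
  symmetrizer by `|R|`); hence `λ₁(A;[n−1,1]) ≤ λ₁^{RW}(A)` (`aldousLambdaOneFin_twoRow_le_gapRW`).

References for this part: Caputo–Liggett–Richthammer, Theorem 1.1 [CaputoLiggettRichthammer2010];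
Alon–Kozma §1 (the theorem of CLR in the form `λ₁(A;[n−1,1]) ≤ λ₁(A;ρ)`) [AlonKozma2013].
Tree: `gapRW_le_rayleighQuotient`, `le_gapRW` (`InterchangeSpectralGap.lean`, where the random-walk gap
`λ₁^{RW}(A)` is the written-out `sInf` of the Rayleigh quotients `∑_{x<y} a_{xy}‖φ x − φ y‖²/‖φ‖²` over `∑ φ = 0`, `φ ≠ 0`);
`isotypicProj_specht_comp_of_ne` (`SymmetricGroupIsotypic.lean`); `spechtCharacter_indiscrete`;
`rowSymmetrizer_mul_of`, `youngSymmetrizer_ne_zero_holds`, `spechtCharacter_one_ne_zero'`;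
`isotypicProj_permLeftRegular_single_ne_zero` (above); Mathlib `LinearMap.IsIdempotentElem.trace_eq_zero_iff`,
`List.Perm.eq_of_sortedGE`.
-/

namespace Literature.RepresentationTheory.FiniteGroups

open _root_.Literature.NumberTheory.DiophantineGeometry
open Equiv Finset

section CLR

variable {n : ℕ}

/-! #### Isotypic components other than `[n]` are orthogonal to the constants -/

/-- The projector of the trivial representation is averaging: `(P_{[n]} f)(τ) = (1/n!) ∑_σ f(σ)`.
[cite: AlonKozma2013, §4 Cor. 2 (proof)] -/
theorem isotypicProj_indiscrete_apply (f : Perm (Fin n) → ℂ) (τ : Perm (Fin n)) :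
    isotypicProj (permLeftRegular n) (spechtCharacter ℂ (Nat.Partition.indiscrete n)) f τ =
      (∑ σ, f σ) / (Fintype.card (Perm (Fin n)) : ℂ) := by
  rw [isotypicProj_apply, Finset.sum_apply]
  simp only [Literature.Barriers.ValiantsHypothesis.spechtCharacter_indiscrete, mul_one, Pi.smul_apply,
    permLeftRegular_apply, inv_inv, smul_eq_mul]
  rw [← Finset.mul_sum, one_div, ← div_eq_inv_mul]
  congr 1
  exact Fintype.sum_equiv (Equiv.mulRight τ) _ _ fun σ => rfl

/-- **For `μ ≠ [n]`, the `μ`-isotypic component of `ℂ[𝔖ₙ]` is orthogonal to the constants**: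
`∑_τ f(τ) = 0` (`P_{[n]} P_μ = 0`). [cite: AlonKozma2013, §1] -/
theorem sum_eq_zero_of_mem_isotypicComponent {μ : Nat.Partition n} (hμ : μ ≠ Nat.Partition.indiscrete n)
    {f : Perm (Fin n) → ℂ} (hf : f ∈ isotypicComponent n μ) : ∑ τ, f τ = 0 := by
  obtain ⟨g, rfl⟩ := LinearMap.mem_range.mp hf
  have h := LinearMap.congr_fun (isotypicProj_specht_comp_of_ne (permLeftRegular n) (Ne.symm hμ)) g
  rw [LinearMap.comp_apply, LinearMap.zero_apply] at h
  have h1 := congrFun h 1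
  rw [isotypicProj_indiscrete_apply, Pi.zero_apply, div_eq_zero_iff] at h1
  exact h1.resolve_right (Nat.cast_ne_zero.mpr Fintype.card_ne_zero)

/-- **`λ₁^{RW}(A) ≤ λ₁(A; μ)` for every `μ ≠ [n]`** (CLR Theorem 1.1 on each isotypic component:
Alon–Kozma §1, "`λ₁(A;ρ)` … the interchange process"). [cite: CaputoLiggettRichthammer2010, Theorem 1.1] -/
theorem gapRW_le_aldousLambdaOneFin (A : Fin n → Fin n → ℝ) (hA : ∀ x y, 0 ≤ A x y)
    {μ : Nat.Partition n} (hμ : μ ≠ Nat.Partition.indiscrete n) :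
    sInf ((fun φ : Fin n → ℂ => (∑ x : Fin n, ∑ y : Fin n with x < y, A x y * ‖φ x - φ y‖ ^ 2) / l2NormSq φ) '' {φ : Fin n → ℂ | ∑ x, φ x = 0 ∧ φ ≠ 0}) ≤
      aldousLambdaOneFin n A μ := by
  unfold aldousLambdaOneFin
  have hmem : isotypicProj (permLeftRegular n) (spechtCharacter ℂ μ) (Pi.single 1 1) ∈ isotypicComponent n μ :=
    LinearMap.mem_range_self _ _
  refine le_csInf ⟨_, _, ⟨hmem, isotypicProj_permLeftRegular_single_ne_zero μ⟩, rfl⟩ ?_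
  rintro _ ⟨f, ⟨hf, hf0⟩, rfl⟩
  exact gapRW_le_rayleighQuotient A hA (sum_eq_zero_of_mem_isotypicComponent hμ hf) hf0

/-! #### One-particle functions -/

/-! One-particle functions `F_φ = (τ ↦ φ(τ q))` (CLR §1.2.2: "the random walk can be obtained as
a sub-process of the interchange process by ignoring all particles apart from the one with label 1",
`π(η) = ξ_1(η)`; here the particle is `q`) are written inline as `fun τ => φ (τ q)`. -/

/-- `F_φ ≠ 0` if `φ ≠ 0`. [folklore] -/
theorem oneParticle_ne_zero (q : Fin n) {φ : Fin n → ℂ} (hφ : φ ≠ 0) : (fun τ : Perm (Fin _) => φ (τ q)) ≠ 0 := by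
  obtain ⟨x, hx⟩ : ∃ x, φ x ≠ 0 := by
    by_contra h
    push Not at h
    exact hφ (funext h)
  intro h
  have := congrFun h (swap q x)
  simp only [swap_apply_left, Pi.zero_apply] at this
  exact hx this

/-- `‖F_φ‖² = (n−1)! ‖φ‖²`. [cite: CaputoLiggettRichthammer2010, §2.2 (before §2.3)] -/
theorem l2NormSq_oneParticle (q : Fin n) (φ : Fin n → ℂ) :
    l2NormSq ((fun τ : Perm (Fin _) => φ (τ q))) = (n - 1).factorial * l2NormSq φ := by
  rw [l2NormSq, l2NormSq]
  have := sum_perm_apply_eq (fun x => ‖φ x‖ ^ 2) q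
  rw [this, Fintype.card_fin, nsmul_eq_mul]

/-- `ν[(∇_{uv} F_φ)²] = (2/n)(φ(u) − φ(v))²` in CLR's normalisation:
`∑_τ ‖F_φ((uv)τ) − F_φ(τ)‖² = (n−1)! · 2‖φ(u) − φ(v)‖²`.
[cite: CaputoLiggettRichthammer2010, §2.2 (after Theorem 2.3)] -/
theorem transpDirichlet_oneParticle (q : Fin n) (φ : Fin n → ℂ) {u v : Fin n} (huv : u ≠ v) :
    transpDirichlet u v ((fun τ : Perm (Fin _) => φ (τ q))) = (n - 1).factorial * (2 * ‖φ u - φ v‖ ^ 2) := by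
  rw [transpDirichlet]
  simp only [Perm.mul_apply]
  have := sum_perm_apply_eq (fun x => ‖φ (swap u v x) - φ x‖ ^ 2) q
  rw [this, Fintype.card_fin, nsmul_eq_mul]
  congr 1
  rw [Fintype.sum_eq_add u v huv]
  · rw [swap_apply_left, swap_apply_right, norm_sub_rev (φ v)]
    ring
  · intro x hx
    rw [swap_apply_of_ne_of_ne hx.1 hx.2, sub_self, norm_zero]
    simp

/-- **The Rayleigh quotient of a one-particle function is the random-walk Rayleigh quotient**:
`R_A(F_φ) = 𝓔^{RW}_A(φ)/‖φ‖²` (the intertwining `𝓛^{IP}(f ∘ π) = (𝓛^{RW} f) ∘ π`, CLR (mcprojection)).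
[cite: CaputoLiggettRichthammer2010, §1.2.2 (mcprojection)] -/
theorem rayleighQuotient_oneParticle (A : Fin n → Fin n → ℝ) (q : Fin n) (φ : Fin n → ℂ) :
    rayleighQuotient n A ((fun τ : Perm (Fin _) => φ (τ q))) =
      (∑ x : Fin n, ∑ y : Fin n with x < y, A x y * ‖φ x - φ y‖ ^ 2) / l2NormSq φ := by
  rw [rayleighQuotient_eq, l2NormSq_oneParticle]
  have hnum : ∑ x : Fin n, ∑ y : Fin n with x < y, A x y * (transpDirichlet x y ((fun τ : Perm (Fin _) => φ (τ q))) / 2) =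
      (n - 1).factorial * ∑ x : Fin n, ∑ y : Fin n with x < y, A x y * ‖φ x - φ y‖ ^ 2 := by
    rw [Finset.mul_sum]
    refine Finset.sum_congr rfl fun x _ => ?_
    rw [Finset.mul_sum]
    refine Finset.sum_congr rfl fun y hy => ?_
    rw [transpDirichlet_oneParticle q φ (Finset.mem_filter.mp hy).2.ne]
    ring
  rw [hnum]
  have hfac : (0 : ℝ) < (n - 1).factorial := by exact_mod_cast Nat.factorial_pos _
  by_cases hφ : l2NormSq φ = 0
  · rw [hφ, mul_zero, div_zero, div_zero]
  · rw [mul_div_mul_left _ _ hfac.ne']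

/-! #### Isotypic projectors act on one-particle functions by scalars -/

/-! Coset sums of a class function, `K(u, w) = ∑_{t : t w = u} χ(t)`, are written inline. -/

/-- Coset sums of a class function are invariant under simultaneous relabelling. [folklore] -/
theorem cosetSum_conj {χ : Perm (Fin n) → ℂ} (hχ : IsClassFun χ) (σ : Perm (Fin n)) (u w : Fin n) :
    (∑ t : Perm (Fin _) with t (σ w) = (σ u), χ t) = (∑ t : Perm (Fin _) with t w = u, χ t) := by
  rw [Finset.sum_filter, Finset.sum_filter]
  refine Fintype.sum_equiv (MulAut.conj σ).toEquiv.symm _ _ fun t => ?_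
  simp only [MulEquiv.toEquiv_eq_coe, MulEquiv.coe_toEquiv_symm, MulAut.conj_symm_apply]
  have heq : (σ⁻¹ * t * σ) w = u ↔ t (σ w) = σ u := by
    rw [Perm.mul_apply, Perm.mul_apply, Perm.inv_eq_iff_eq]
  have hχt : χ (σ⁻¹ * t * σ) = χ t := by
    have := hχ t σ⁻¹
    rwa [inv_inv] at this
  by_cases h : t (σ w) = σ u
  · rw [if_pos h, if_pos (heq.mpr h), hχt]
  · rw [if_neg h, if_neg (fun h' => h (heq.mp h'))]

/-- A permutation with two prescribed values. [folklore] -/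
theorem exists_perm_apply_eq (q u₀ w u : Fin n) (hq : u₀ ≠ q) (huw : u ≠ w) :
    ∃ σ : Perm (Fin n), σ q = w ∧ σ u₀ = u := by
  set u₁ := swap q w u₀ with hu₁
  have hu₁w : u₁ ≠ w := by
    rw [hu₁]
    intro h
    have := (swap q w).injective (h.trans (swap_apply_left q w).symm)
    exact hq this
  refine ⟨swap u₁ u * swap q w, ?_, ?_⟩
  · rw [Perm.mul_apply, swap_apply_left, swap_apply_of_ne_of_ne hu₁w.symm huw.symm]
  · rw [Perm.mul_apply, ← hu₁, swap_apply_left]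

/-- Off the diagonal the coset sums of a class function are constant. [folklore] -/
theorem cosetSum_eq_of_ne {χ : Perm (Fin n) → ℂ} (hχ : IsClassFun χ) {q u₀ : Fin n} (hq : u₀ ≠ q)
    {u w : Fin n} (huw : u ≠ w) : (∑ t : Perm (Fin _) with t w = u, χ t) = (∑ t : Perm (Fin _) with t q = u₀, χ t) := by
  obtain ⟨σ, hσq, hσu⟩ := exists_perm_apply_eq q u₀ w u hq huw
  rw [← hσu, ← hσq, cosetSum_conj hχ]

/-- On the diagonal the coset sums of a class function are constant. [folklore] -/
theorem cosetSum_self_eq {χ : Perm (Fin n) → ℂ} (hχ : IsClassFun χ) (q w : Fin n) :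
    (∑ t : Perm (Fin _) with t w = w, χ t) = (∑ t : Perm (Fin _) with t q = q, χ t) := by
  have := cosetSum_conj hχ (swap q w) q q
  rwa [swap_apply_left] at this

/-- **Isotypic projectors act on one-particle functions by scalars.** For a class function `χ` and
`φ` with `∑ φ = 0`: `P_χ F_φ = (χ(1)/n!)·(K(q,q) − K(u₀,q))·F_φ`, where `K` are the coset sums of
`χ` over `{t | t q = q}` and `{t | t q = u₀}` (`u₀ ≠ q`). [cite: AlonKozma2013, §1] -/
theorem isotypicProj_oneParticle {χ : Perm (Fin n) → ℂ} (hχ : IsClassFun χ) {q u₀ : Fin n} (hq : u₀ ≠ q)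
    {φ : Fin n → ℂ} (hφ : ∑ x, φ x = 0) :
    isotypicProj (permLeftRegular n) χ ((fun τ : Perm (Fin _) => φ (τ q))) =
      (χ 1 / Fintype.card (Perm (Fin n)) * ((∑ t : Perm (Fin _) with t q = q, χ t) - (∑ t : Perm (Fin _) with t q = u₀, χ t))) • (fun τ : Perm (Fin _) => φ (τ q)) := by
  funext τ
  rw [isotypicProj_apply, Finset.sum_apply, Pi.smul_apply, smul_eq_mul]
  simp only [Pi.smul_apply, permLeftRegular_apply, inv_inv, smul_eq_mul, Perm.mul_apply]
  simp_rw [mul_assoc]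
  rw [← Finset.mul_sum]
  congr 1
  set w := τ q with hw
  -- fibre over `t w`
  rw [← Finset.sum_fiberwise_of_maps_to (g := fun t : Perm (Fin n) => t w) (t := Finset.univ)
    (fun _ _ => Finset.mem_univ _)]
  have hfib : ∀ u, ∑ t : Perm (Fin n) with t w = u, χ t * φ (t w) = (∑ t : Perm (Fin _) with t w = u, χ t) * φ u := by
    intro u
    rw [Finset.sum_mul]
    refine Finset.sum_congr rfl fun t ht => ?_
    rw [(Finset.mem_filter.mp ht).2]
  rw [Finset.sum_congr rfl fun u _ => hfib u]
  -- split the diagonal term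
  rw [← Finset.add_sum_erase _ _ (Finset.mem_univ w), cosetSum_self_eq hχ q w]
  have hoff : ∀ u ∈ Finset.univ.erase w, (∑ t : Perm (Fin _) with t w = u, χ t) * φ u = (∑ t : Perm (Fin _) with t q = u₀, χ t) * φ u := by
    intro u hu
    rw [cosetSum_eq_of_ne hχ hq (Finset.ne_of_mem_erase hu)]
  rw [Finset.sum_congr rfl hoff, ← Finset.mul_sum, Finset.sum_erase_eq_sub (Finset.mem_univ w), hφ, zero_sub]
  ring

/-! #### The tableau of shape `[n−1, 1]` -/

/-- The sorted parts of the partition `[n−1, 1]`. [folklore] -/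
theorem sortedParts_twoRow {ν : Nat.Partition n} (hν : ν.parts = ({n - 1, 1} : Multiset ℕ)) :
    ν.sortedParts = [n - 1, 1] := by
  have h1 : 1 ≤ n - 1 := by
    have hpos := ν.parts_pos (show n - 1 ∈ ν.parts by rw [hν]; simp)
    omega
  have hperm : ν.sortedParts.Perm [n - 1, 1] := by
    rw [← Multiset.coe_eq_coe, Nat.Partition.sortedParts, Multiset.sort_eq, hν]
    rfl
  refine hperm.eq_of_sortedGE ν.sortedGE_sortedParts ?_
  rw [List.sortedGE_iff_pairwise]
  simp [h1]

/-- The rows of the canonical tableau of shape `[n−1, 1]`: the last entry alone lies in row `1`.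
[folklore] -/
theorem rowOf_twoRow {ν : Nat.Partition n} (hν : ν.parts = ({n - 1, 1} : Multiset ℕ)) (i : Fin n) :
    ν.rowOf i = if (i : ℕ) < n - 1 then 0 else 1 := by
  have hs := sortedParts_twoRow hν
  split_ifs with hi
  · refine ν.rowOf_eq_of_le_of_lt i (by rw [hs]; simp) (by simp) ?_
    rw [hs]
    simpa using hi
  · refine ν.rowOf_eq_of_le_of_lt i (by rw [hs]; simp) ?_ ?_
    · rw [hs]
      simpa using hi
    · rw [hs]
      simp only [List.take_succ_cons, List.take_zero, List.sum_cons, List.sum_nil, add_zero]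
      omega

/-- **The row stabilizer of the tableau of shape `[n−1, 1]` is the stabilizer of the last entry.**
[folklore] -/
theorem mem_rowStabilizer_twoRow {k : ℕ} {ν : Nat.Partition (k + 1)}
    (hν : ν.parts = ({k + 1 - 1, 1} : Multiset ℕ)) (σ : Perm (Fin (k + 1))) :
    σ ∈ rowStabilizer ν ↔ σ (Fin.last k) = Fin.last k := by
  have hrow : ∀ i : Fin (k + 1), ν.rowOf i = if i = Fin.last k then 1 else 0 := by
    intro i
    rw [rowOf_twoRow hν]
    by_cases hi : i = Fin.last k
    · rw [if_pos hi, if_neg]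
      rw [hi, Fin.val_last]
      omega
    · rw [if_neg hi, if_pos]
      have := Fin.val_lt_last hi
      simpa using this
  rw [mem_rowStabilizer_iff]
  simp_rw [hrow]
  constructor
  · intro h
    have := h (Fin.last k)
    rw [if_pos rfl] at this
    by_contra hne
    rw [if_neg hne] at this
    exact zero_ne_one this
  · intro h i
    by_cases hi : i = Fin.last k
    · rw [hi, h]
    · rw [if_neg hi, if_neg]
      intro e
      exact hi (σ.injective (e.trans h.symm))

/-! #### `∑_{t(q) = q} χ^{[n−1,1]}(t) ≠ 0` -/

/-- **The stabilizer sum does not vanish on the Specht character of `[n−1,1]`**: the operator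
`T = ∑_{t ∈ R} ρ(t)` on `S^ν` (`R` the row stabilizer = stabilizer of the last entry) satisfies
`T² = |R| T` and `T c_ν = |R| c_ν ≠ 0`, so `T/|R|` is a non-zero idempotent and
`tr T = ∑_{t ∈ R} χ^ν(t) ≠ 0` (the restriction of `[n−1,1]` to `𝔖_{n−1}` contains the trivial
representation). [folklore] -/
theorem sum_spechtCharacter_stabilizer_ne_zero {k : ℕ} {ν : Nat.Partition (k + 1)}
    (hν : ν.parts = ({k + 1 - 1, 1} : Multiset ℕ)) :
    ∑ t : Perm (Fin (k + 1)) with t (Fin.last k) = Fin.last k, spechtCharacter ℂ ν t ≠ 0 := by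
  classical
  set R : Finset (Perm (Fin (k + 1))) := Finset.univ.filter (fun t => t (Fin.last k) = Fin.last k) with hR
  have hRmem : ∀ t, t ∈ R ↔ t ∈ rowStabilizer ν := fun t => by
    rw [hR, Finset.mem_filter, mem_rowStabilizer_twoRow hν]
    simp
  have hRmul : ∀ s ∈ R, ∀ t ∈ R, s * t ∈ R := fun s hs t ht =>
    (hRmem _).mpr ((rowStabilizer ν).mul_mem ((hRmem s).mp hs) ((hRmem t).mp ht))
  -- the operator `T`
  set ρ := spechtRep ℂ ν with hρ
  set T : Module.End ℂ (spechtIdeal ℂ ν) := ∑ t ∈ R, ρ t with hT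
  -- `tr T = ∑_{t ∈ R} χ(t)`
  have htr : LinearMap.trace ℂ _ T = ∑ t ∈ R, spechtCharacter ℂ ν t := by
    rw [hT, map_sum]
    rfl
  -- `T² = |R| T`
  have hsq : T * T = (R.card : ℂ) • T := by
    rw [hT, Finset.sum_mul_sum]
    have hinner : ∀ s ∈ R, ∑ t ∈ R, ρ s * ρ t = ∑ t ∈ R, ρ t := by
      intro s hs
      simp_rw [← map_mul]
      refine Finset.sum_nbij (fun t => s * t) (fun t ht => hRmul s hs t ht) ?_ ?_ (fun _ _ => rfl)
      · intro t₁ _ t₂ _ h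
        exact mul_left_cancel h
      · intro u hu
        exact ⟨s⁻¹ * u, (hRmem _).mpr ((rowStabilizer ν).mul_mem ((rowStabilizer ν).inv_mem ((hRmem s).mp hs))
          ((hRmem u).mp hu)), by simp⟩
    rw [Finset.sum_congr rfl hinner, Finset.sum_const, Nat.cast_smul_eq_nsmul]
  -- `T c_ν = |R| c_ν`, so `T ≠ 0`
  have hne : T ≠ 0 := by
    intro h0
    have hc : (⟨youngSymmetrizer ℂ ν, youngSymmetrizer_mem_spechtIdeal ℂ ν⟩ : spechtIdeal ℂ ν) ∈
        (⊤ : Submodule ℂ (spechtIdeal ℂ ν)) := Submodule.mem_top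
    have happ := LinearMap.congr_fun h0 ⟨youngSymmetrizer ℂ ν, youngSymmetrizer_mem_spechtIdeal ℂ ν⟩
    rw [LinearMap.zero_apply, hT, LinearMap.sum_apply] at happ
    have hval := congrArg Subtype.val happ
    rw [Submodule.coe_sum (M := MonoidAlgebra ℂ (Perm (Fin (k + 1))))] at hval
    simp only [hρ, spechtRep_apply, ZeroMemClass.coe_zero] at hval
    rw [← Finset.sum_mul] at hval
    -- `∑_{t ∈ R} t = a_ν`
    have hsum : ∑ t ∈ R, MonoidAlgebra.of ℂ _ t = rowSymmetrizer ℂ ν := by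
      rw [rowSymmetrizer]
      refine Finset.sum_congr ?_ fun _ _ => rfl
      ext t
      rw [hRmem, Set.mem_toFinset]
      rfl
    rw [hsum, youngSymmetrizer, ← mul_assoc] at hval
    -- `a_ν a_ν = |R| a_ν`
    have haa : rowSymmetrizer ℂ ν * rowSymmetrizer ℂ ν = (R.card : ℂ) • rowSymmetrizer ℂ ν := by
      conv_lhs => enter [2]; rw [← hsum]
      rw [Finset.mul_sum, Finset.sum_congr rfl fun t ht => rowSymmetrizer_mul_of ((hRmem t).mp ht),
        Finset.sum_const, Nat.cast_smul_eq_nsmul]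
    rw [haa, smul_mul_assoc, ← youngSymmetrizer, smul_eq_zero] at hval
    rcases hval with h | h
    · have : (1 : Perm (Fin (k + 1))) ∈ R := (hRmem 1).mpr (rowStabilizer ν).one_mem
      exact absurd (Nat.cast_eq_zero.mp h) (Finset.card_ne_zero_of_mem this)
    · exact youngSymmetrizer_ne_zero_holds ℂ ν h
  -- the idempotent `T/|R|`
  have hcard : (R.card : ℂ) ≠ 0 := by
    have : (1 : Perm (Fin (k + 1))) ∈ R := (hRmem 1).mpr (rowStabilizer ν).one_mem
    exact Nat.cast_ne_zero.mpr (Finset.card_ne_zero_of_mem this)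
  set e : Module.End ℂ (spechtIdeal ℂ ν) := (R.card : ℂ)⁻¹ • T with he
  have hidem : IsIdempotentElem e := by
    rw [IsIdempotentElem, he, smul_mul_smul_comm, hsq, smul_smul, mul_assoc, inv_mul_cancel₀ hcard, mul_one]
  have he0 : e ≠ 0 := by
    rw [he]
    exact smul_ne_zero (inv_ne_zero hcard) hne
  haveI : Module.Free ℂ (LinearMap.range e) := Module.Free.of_divisionRing ℂ (LinearMap.range e)
  haveI : Module.Free ℂ (LinearMap.ker e) := Module.Free.of_divisionRing ℂ (LinearMap.ker e)
  have htre : LinearMap.trace ℂ _ e ≠ 0 := fun h => he0 ((LinearMap.IsIdempotentElem.trace_eq_zero_iff hidem).mp h)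
  rw [he, map_smul, smul_eq_mul] at htre
  rw [← htr]
  exact fun h => htre (by rw [h, mul_zero])

/-! #### One-particle functions lie in the `[n−1,1]`-isotypic component -/

/-- `∑_t χ^μ(t) = 0` for `μ ≠ [n]` (orthogonality to the trivial character). [folklore] -/
theorem sum_spechtCharacter_eq_zero {μ : Nat.Partition n} (hμ : μ ≠ Nat.Partition.indiscrete n) :
    ∑ t, spechtCharacter ℂ μ t = 0 := by
  have hP : isotypicProj (permLeftRegular n) (spechtCharacter ℂ μ) (fun _ => (1 : ℂ)) =
      (spechtCharacter ℂ μ 1 / Fintype.card (Perm (Fin n)) * ∑ t, spechtCharacter ℂ μ t) • fun _ => (1 : ℂ) := by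
    funext τ
    rw [isotypicProj_apply, Finset.sum_apply, Pi.smul_apply, smul_eq_mul, mul_one, Finset.mul_sum]
    refine Finset.sum_congr rfl fun t _ => ?_
    rw [Pi.smul_apply, permLeftRegular_apply, smul_eq_mul, mul_one]
  have hmem : ((spechtCharacter ℂ μ 1 / Fintype.card (Perm (Fin n)) * ∑ t, spechtCharacter ℂ μ t) •
      fun _ : Perm (Fin n) => (1 : ℂ)) ∈ isotypicComponent n μ := by
    rw [← hP]
    exact LinearMap.mem_range_self _ _
  have h := sum_eq_zero_of_mem_isotypicComponent hμ hmem
  simp only [Pi.smul_apply, smul_eq_mul, mul_one, Finset.sum_const, Finset.card_univ, nsmul_eq_mul] at h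
  have hc : spechtCharacter ℂ μ 1 / Fintype.card (Perm (Fin n)) ≠ 0 :=
    div_ne_zero (spechtCharacter_one_ne_zero' μ) (Nat.cast_ne_zero.mpr Fintype.card_ne_zero)
  have hcard : (Fintype.card (Perm (Fin n)) : ℂ) ≠ 0 := Nat.cast_ne_zero.mpr Fintype.card_ne_zero
  exact (mul_eq_zero.mp ((mul_eq_zero.mp h).resolve_left hcard)).resolve_left hc

/-- The partition `[n−1,1]` is not `[n]`. [folklore] -/
theorem ne_indiscrete_of_parts_eq {ν : Nat.Partition n} (hν : ν.parts = ({n - 1, 1} : Multiset ℕ)) :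
    ν ≠ Nat.Partition.indiscrete n := by
  intro h
  have hn : n ≠ 0 := by
    have hpos := ν.parts_pos (show 1 ∈ ν.parts by rw [hν]; simp)
    have := ν.parts_sum
    intro hn
    subst hn
    rw [hν] at this
    simp at this
  have hcard := congrArg Multiset.card (h ▸ hν : (Nat.Partition.indiscrete n).parts = _)
  rw [Nat.Partition.indiscrete_parts hn] at hcard
  simp at hcard

/-- **One-particle functions with `∑ φ = 0` lie in the `[n−1,1]`-isotypic component of `ℂ[𝔖ₙ]`**
("`[n−1,1] ⊕ [n]` is the natural permutation representation": the random-walk eigenfunctions live in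
`[n−1,1]`, Alon–Kozma §1 / CLR §2.3). [cite: AlonKozma2013, §1] -/
theorem oneParticle_mem_isotypicComponent {k : ℕ} (hk : 1 ≤ k) {ν : Nat.Partition (k + 1)}
    (hν : ν.parts = ({k + 1 - 1, 1} : Multiset ℕ)) {φ : Fin (k + 1) → ℂ} (hφ : ∑ x, φ x = 0) :
    (fun τ : Perm (Fin (k + 1)) => φ (τ (Fin.last k))) ∈ isotypicComponent (k + 1) ν := by
  set q : Fin (k + 1) := Fin.last k with hq
  have h0q : (0 : Fin (k + 1)) ≠ q := by
    rw [hq]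
    intro h
    have := congrArg Fin.val h
    simp at this
    omega
  have hclass : IsClassFun (spechtCharacter ℂ ν) := (isIrrChar_spechtCharacter ν).isCharacter.isClassFun
  have hP := isotypicProj_oneParticle hclass h0q hφ
  set α : ℂ := spechtCharacter ℂ ν 1 / Fintype.card (Perm (Fin (k + 1))) *
    ((∑ t : Perm (Fin _) with t q = q, (spechtCharacter ℂ ν) t) - (∑ t : Perm (Fin _) with t q = 0, (spechtCharacter ℂ ν) t)) with hα
  -- the scalar is non-zero
  have hK : (∑ t : Perm (Fin _) with t q = q, (spechtCharacter ℂ ν) t) + k * (∑ t : Perm (Fin _) with t q = 0, (spechtCharacter ℂ ν) t) = 0 := by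
    have htot : ∑ t, spechtCharacter ℂ ν t = ∑ u, (∑ t : Perm (Fin _) with t q = u, (spechtCharacter ℂ ν) t) := by
      rw [← Finset.sum_fiberwise_of_maps_to (g := fun t : Perm (Fin (k + 1)) => t q) (t := Finset.univ)
        (fun _ _ => Finset.mem_univ _)]
    rw [sum_spechtCharacter_eq_zero (ne_indiscrete_of_parts_eq hν), ← Finset.add_sum_erase _ _ (Finset.mem_univ q),
      Finset.sum_congr rfl fun u hu => cosetSum_eq_of_ne hclass h0q (Finset.ne_of_mem_erase hu), Finset.sum_const,
      Finset.card_erase_of_mem (Finset.mem_univ q), Finset.card_univ, Fintype.card_fin, nsmul_eq_mul] at htot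
    simp only [add_tsub_cancel_right] at htot
    exact htot.symm
  have hK0 : (∑ t : Perm (Fin _) with t q = q, (spechtCharacter ℂ ν) t) ≠ 0 := sum_spechtCharacter_stabilizer_ne_zero hν
  have hα0 : α ≠ 0 := by
    rw [hα]
    refine mul_ne_zero (div_ne_zero (spechtCharacter_one_ne_zero' ν) (Nat.cast_ne_zero.mpr Fintype.card_ne_zero)) ?_
    intro h
    have hk0 : (k : ℂ) ≠ 0 := Nat.cast_ne_zero.mpr (by omega)
    have : (k + 1 : ℂ) * (∑ t : Perm (Fin _) with t q = q, (spechtCharacter ℂ ν) t) = 0 := by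
      have e1 := hK
      have e2 : (∑ t : Perm (Fin _) with t q = q, (spechtCharacter ℂ ν) t) = (∑ t : Perm (Fin _) with t q = 0, (spechtCharacter ℂ ν) t) := sub_eq_zero.mp h
      rw [← e2] at e1
      linear_combination e1
    rw [mul_eq_zero] at this
    rcases this with h1 | h1
    · exact absurd h1 (by exact_mod_cast Nat.succ_ne_zero k)
    · exact hK0 h1
  -- conclude
  have : (fun τ : Perm (Fin _) => φ (τ q)) = isotypicProj (permLeftRegular (k + 1)) (spechtCharacter ℂ ν) (α⁻¹ • (fun τ : Perm (Fin _) => φ (τ q))) := by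
    rw [map_smul, hP, smul_smul, inv_mul_cancel₀ hα0, one_smul]
  rw [this]
  exact LinearMap.mem_range_self _ _

/-- **`λ₁(A;[n−1,1]) ≤ λ₁^{RW}(A)`**: the `[n−1,1]`-isotypic component contains the one-particle
functions, whose Rayleigh quotients are the random-walk Rayleigh quotients (Alon–Kozma §1:
"`λ₁(A;[n−1,1])` is the spectral gap of the random walk"). [cite: AlonKozma2013, §1] -/
theorem aldousLambdaOneFin_twoRow_le_gapRW {k : ℕ} (hk : 1 ≤ k) (A : Fin (k + 1) → Fin (k + 1) → ℝ)
    (hA : ∀ x y, 0 ≤ A x y) {ν : Nat.Partition (k + 1)} (hν : ν.parts = ({k + 1 - 1, 1} : Multiset ℕ)) :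
    aldousLambdaOneFin (k + 1) A ν ≤
      sInf ((fun φ : Fin (k + 1) → ℂ => (∑ x : Fin (k + 1), ∑ y : Fin (k + 1) with x < y, A x y * ‖φ x - φ y‖ ^ 2) / l2NormSq φ) '' {φ : Fin (k + 1) → ℂ | ∑ x, φ x = 0 ∧ φ ≠ 0}) := by
  refine le_gapRW (by omega) fun φ hφ hφ0 => ?_
  unfold aldousLambdaOneFin
  refine csInf_le ⟨0, ?_⟩ ⟨(fun τ : Perm (Fin (k + 1)) => φ (τ (Fin.last k))),
    ⟨oneParticle_mem_isotypicComponent hk hν hφ, oneParticle_ne_zero _ hφ0⟩, rayleighQuotient_oneParticle A _ φ⟩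
  rintro _ ⟨f, -, rfl⟩
  exact rayleighQuotient_nonneg (k + 1) hA f

/-- **The Caputo–Liggett–Richthammer theorem (Aldous' spectral gap conjecture), discharged**:
for all non-negative rates `A` on `n` sites and every `μ ≠ [n]`,
`λ₁(A; [n−1,1]) ≤ λ₁(A; μ)` (Alon–Kozma §1, "Theorem (Caputo, Liggett & Richthammer)"; CLR Theorem 1.1,
`λ₁^{IP} = λ₁^{RW}`). Proof: `λ₁(A;[n−1,1]) ≤ λ₁^{RW}(A)` (one-particle functions) and
`λ₁^{RW}(A) ≤ λ₁(A;μ)` (CLR Theorem 1.1 in Dirichlet-form language, `clr_spectralGap`, on the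
`μ`-isotypic component, which is orthogonal to the constants).
[cite: CaputoLiggettRichthammer2010, Theorem 1.1] [cite: AlonKozma2013, §1 Theorem (CLR)] -/
theorem CaputoLiggettRichthammer_lambdaOne_holds : CaputoLiggettRichthammer_lambdaOne := by
  intro n A hA μ ν hν hμ
  -- `n ≥ 2`
  obtain ⟨k, rfl⟩ : ∃ k, n = k + 1 := by
    have hpos := ν.parts_pos (show 1 ∈ ν.parts by rw [hν]; simp)
    have hsum := ν.parts_sum
    rcases n with _ | k
    · rw [hν] at hsum
      simp at hsum
    · exact ⟨k, rfl⟩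
  have hk : 1 ≤ k := by
    have hpos := ν.parts_pos (show k + 1 - 1 ∈ ν.parts by rw [hν]; simp)
    omega
  exact (aldousLambdaOneFin_twoRow_le_gapRW hk A hA hν).trans (gapRW_le_aldousLambdaOneFin A hA hμ)

end CLR

end Literature.RepresentationTheory.FiniteGroups

end
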